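import Summits.NavierStokesRegularity.FunctionalMining.StretchingLowerCellular
import Summits.NavierStokesRegularity.FunctionalMining.StretchingFillerPotential
import Summits.NavierStokesRegularity.FunctionalMining.StretchingConfinementLemma
import HarnessLib

/-!
# K1-Q1, the wrap blueprint: node N3− `PlanarFillerFamilyPotMinus` holds

Cell `pub-nsfunc` (host summit NavierStokesRegularity, topic `FunctionalMining`), prove seat gen 5, kernel proof of node
**N3− `PlanarFillerFamilyPotMinus`** of the bank seat's `WRAP-KERNEL-BLUEPRINT.md` §6 as typed by the dictionary
seat in `StretchingWrapIdentity.lean`. **Search for candidate a priori estimates; no regularity claim.** Static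
facts about smooth fields on `T³`.

The filler is the exact-plateau cellular field `u_{ε,m}` of `StretchingLowerCellular*.lean` (tubes along `e₂`,
`|ω|² ≤ 4`, `σ → 2`, `ℰ → 2`), halved: `F = ½u` has `|ω|² ≤ 1`, `σ(F) → ¼`, `ℰ(F) → ½`, and — the new estimate
here — second moments `T₂₂(F) = ½(1 − slack) → ½` (the tube vorticity `ζ = −Q'(y₀) − Q'(y₁)`, cross term
`(∫Q')² = 0`) and `T₁₁(F) ≤ ½a²ι² + ½K → ¼` (the wave component `∂₀w`, whose two aligned pieces have disjoint
supports), so `T₂₂ − T₁₁ → ¼`. The potential form `F = curl A` (up to the irrelevant mean) is supplied by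
`Confinement.exists_potential`. Headline: `planarFillerFamilyPotMinus_holds : PlanarFillerFamilyPotMinus`.
-/

noncomputable section

open MeasureTheory Set Filter Topology Function
open scoped InnerProductSpace ContDiff

namespace Summit.NavierStokesRegularity.FunctionalMining

open Literature.Analysis Literature.Analysis.FunctionSpaces Literature.Analysis.FunctionSpaces.Torus
open Literature.Analysis.FluidPDE Literature.Analysis.FluidPDE.Torus

namespace FillerMinus

open CellularStretching Confinement WrapStretching

/-! ## 1. Second moments of the cellular field -/

section Moments

variable (Q N H : ShearProfile)

/-- `ω₂ = −Q'(y₀) − Q'(y₁)` for the cellular field. [ours; elementary] -/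
theorem vorticityComp_two_u (x : UnitAddTorus (Fin 3)) :
    vorticityComp (u Q N H) x 2 = -Q.D.onCircle (planarProj x 0) - Q.D.onCircle (planarProj x 1) := by
  rw [vorticityComp_eq, show (2 : Fin 3) + 1 = 0 from rfl, show (2 : Fin 3) + 2 = 1 from rfl,
    (partialDeriv_zero_u Q N H x).2.1, (partialDeriv_one_u Q N H x).1]

/-- `ω₁ = −∂₀w` for the cellular field. [ours; elementary] -/
theorem vorticityComp_one_u (x : UnitAddTorus (Fin 3)) :
    vorticityComp (u Q N H) x 1 = -Torus.partialDeriv 0 (w N H) (planarProj x) := by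
  rw [vorticityComp_eq, show (1 : Fin 3) + 1 = 2 from rfl, show (1 : Fin 3) + 2 = 0 from rfl,
    (partialDeriv_zero_u Q N H x).2.2, partialDeriv_two_u]
  simp

/-- `∫_T P' = 0` for a periodic profile. [folklore] -/
theorem integral_D_onCircle (P : ShearProfile) : ∫ b, P.D.onCircle b = 0 := by
  rw [integral_circle_eq_intervalIntegral]
  simp only [ShearProfile.onCircle_coe, ShearProfile.D_apply]
  rw [intervalIntegral.integral_deriv_eq_sub (fun t _ => (P.contDiff.differentiable (by simp)).differentiableAt)
    (by simpa [ShearProfile.coe_D] using P.D.continuous.intervalIntegrable 0 1)]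
  have := P.periodic 0
  rw [zero_add] at this
  rw [this, sub_self]

/-- **`T₂₂(u) = 2·∫₀¹Q'²`** (the tube component; the cross term is `(∫Q')² = 0`). [ours] -/
theorem vorticityMoment_two_two_u : vorticityMoment (u Q N H) 2 2 = 2 * msqD Q := by
  rw [vorticityMoment]
  have hpt : (fun x => vorticityComp (u Q N H) x 2 * vorticityComp (u Q N H) x 2) = fun x =>
      (fun y : UnitAddTorus (Fin 2) => (Q.D.onCircle (y 0) + Q.D.onCircle (y 1)) ^ 2) (planarProj x) := by
    funext x; rw [vorticityComp_two_u]; ring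
  have hc : Continuous fun y : UnitAddTorus (Fin 2) => (Q.D.onCircle (y 0) + Q.D.onCircle (y 1)) ^ 2 :=
    ((continuous_onCircle_coord Q.D 0).add (continuous_onCircle_coord Q.D 1)).pow 2
  rw [hpt, integral_comp_planarProj hc.aestronglyMeasurable]
  have e : (fun y : UnitAddTorus (Fin 2) => (Q.D.onCircle (y 0) + Q.D.onCircle (y 1)) ^ 2) = fun y =>
      Q.D.onCircle (y 0) ^ 2 + Q.D.onCircle (y 1) ^ 2 + 2 * (Q.D.onCircle (y 0) * Q.D.onCircle (y 1)) := by
    funext y; ring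
  have i0 : Integrable (fun y : UnitAddTorus (Fin 2) => Q.D.onCircle (y 0) ^ 2) volume :=
    ((continuous_onCircle_coord Q.D 0).pow 2).integrable_unitAddTorus
  have i1 : Integrable (fun y : UnitAddTorus (Fin 2) => Q.D.onCircle (y 1) ^ 2) volume :=
    ((continuous_onCircle_coord Q.D 1).pow 2).integrable_unitAddTorus
  have i00 : Integrable (fun y : UnitAddTorus (Fin 2) => Q.D.onCircle (y 0) ^ 2 + Q.D.onCircle (y 1) ^ 2) volume :=
    i0.add i1
  have i01 : Integrable (fun y : UnitAddTorus (Fin 2) => 2 * (Q.D.onCircle (y 0) * Q.D.onCircle (y 1))) volume :=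
    (((continuous_onCircle_coord Q.D 0).mul (continuous_onCircle_coord Q.D 1)).const_mul 2).integrable_unitAddTorus
  rw [e, integral_add i00 i01, integral_add i0 i1, integral_const_mul, integral_mul_coord,
    integral_D_onCircle, integral_sq_D_coord, integral_sq_D_coord]
  ring

/-- **`T₁₁(u) = ∫ (∂₀w)²`** (the wave component along the compressive axis). [ours] -/
theorem vorticityMoment_one_one_u :
    vorticityMoment (u Q N H) 1 1 = ∫ y : UnitAddTorus (Fin 2), Torus.partialDeriv 0 (w N H) y ^ 2 := by
  rw [vorticityMoment]
  have hpt : (fun x => vorticityComp (u Q N H) x 1 * vorticityComp (u Q N H) x 1) = fun x =>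
      (fun y : UnitAddTorus (Fin 2) => Torus.partialDeriv 0 (w N H) y ^ 2) (planarProj x) := by
    funext x; rw [vorticityComp_one_u]; ring
  have hc : Continuous fun y : UnitAddTorus (Fin 2) => Torus.partialDeriv 0 (w N H) y ^ 2 :=
    (continuous_partialDeriv_w N H 0).pow 2
  rw [hpt, integral_comp_planarProj hc.aestronglyMeasurable]

end Moments

/-! ## 2. The wave moment bound `(∂₀w)² ≤ ½·mainTerm + 2K` -/

section WaveMoment

variable {ε : ℝ} (hε : 0 < ε) (hε' : ε ≤ 1 / 32) (m : ℕ) (a : ℝ)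

/-- `|xyz| ≤ s t r` from `|x| ≤ s`, `|y| ≤ t`, `|z| ≤ r`. [folklore] -/
private theorem abs_mul₃_le {x y z s t r : ℝ} (hx : |x| ≤ s) (hy : |y| ≤ t) (hz : |z| ≤ r) : |x * y * z| ≤ s * t * r := by
  rw [abs_mul, abs_mul]
  have hs : 0 ≤ s := (abs_nonneg _).trans hx
  exact mul_le_mul (mul_le_mul hx hy (abs_nonneg _) hs) hz (abs_nonneg _) (mul_nonneg hs ((abs_nonneg _).trans hy))

/-- Algebra of the wave derivative: with `X X' α α'` the four pieces of `∂₀w`, `X·X' = 0`, `|X|,|X'| ≤ a₀`,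
`|α|,|α'| ≤ ℓ`: `(α + X + (α' + X'))² ≤ X² + X'² + (8a₀ℓ + 4ℓ²)`. [folklore] -/
theorem sq_sum_four_le {X X' α α' a₀ ℓ : ℝ} (hXX : X * X' = 0) (hX : |X| ≤ a₀) (hX' : |X'| ≤ a₀) (hα : |α| ≤ ℓ)
    (hα' : |α'| ≤ ℓ) : (α + X + (α' + X')) ^ 2 ≤ X ^ 2 + X' ^ 2 + (8 * a₀ * ℓ + 4 * ℓ ^ 2) := by
  have ha₀ : 0 ≤ a₀ := (abs_nonneg _).trans hX
  have hℓ : 0 ≤ ℓ := (abs_nonneg _).trans hα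
  have h1 : |(X + X') * (α + α')| ≤ 2 * a₀ * (2 * ℓ) := by
    rw [abs_mul]
    exact mul_le_mul ((abs_add_le _ _).trans (by linarith)) ((abs_add_le _ _).trans (by linarith)) (abs_nonneg _)
      (by linarith)
  have h2 : |(α + α') * (α + α')| ≤ 2 * ℓ * (2 * ℓ) := by
    rw [abs_mul]
    exact mul_le_mul ((abs_add_le _ _).trans (by linarith)) ((abs_add_le _ _).trans (by linarith)) (abs_nonneg _)
      (by linarith)
  have e : (α + X + (α' + X')) ^ 2 = X ^ 2 + X' ^ 2 + 2 * (X * X') + 2 * ((X + X') * (α + α')) +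
      (α + α') * (α + α') := by ring
  rw [e, hXX]
  linarith [(abs_le.1 h1).2, (abs_le.1 h2).2]

include hε hε' in
/-- **`(∂₀w)² ≤ ½·mainTerm + 2K`** for the cellular field (the two aligned pieces have disjoint supports). [ours] -/
theorem sq_partialDeriv_zero_w_le (y : UnitAddTorus (Fin 2)) :
    Torus.partialDeriv 0 (w (envM hε hε') (wave hε hε' m a)) y ^ 2 ≤
      2⁻¹ * mainTerm (envM hε hε') (wave hε hε' m a) y + 2 * Kc ε m a := by
  have hw0 := partialDeriv_zero_w (envM hε hε') (wave hε hε' m a) y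
  simp only [EA, EB, coordForm_one_zero, coordForm_zero_one] at hw0
  have em : 2⁻¹ * mainTerm (envM hε hε') (wave hε hε' m a) y =
      ((shift (envM hε hε') 2⁻¹).onCircle (y 0) * (envM hε hε').onCircle (y 1) *
          (wave hε hε' m a).D.onCircle (y 0 + y 1)) ^ 2 +
        ((envM hε hε').onCircle (y 0) * (shift (envM hε hε') 2⁻¹).onCircle (y 1) *
          (wave hε hε' m a).D.onCircle (y 0 - y 1)) ^ 2 := by
    simp only [mainTerm]; ring
  have eK : 2 * Kc ε m a = 8 * |a| * (envLip ε * |a / m|) + 4 * (envLip ε * |a / m|) ^ 2 := by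
    simp only [Kc]; ring
  rw [hw0, em, eK]
  -- `A·C = 0`: the two envelopes at `y 0` have disjoint supports
  have hAC : (shift (envM hε hε') 2⁻¹).onCircle (y 0) * (envM hε hε').onCircle (y 0) = 0 := by
    by_contra hne
    rcases mul_ne_zero_iff.1 hne with ⟨hA, hC⟩
    have h1 := support_envP hε hε' (y 0) (Or.inl hA)
    have h2 := support_envM hε hε' (y 0) (Or.inl hC)
    rw [h1] at h2; norm_num at h2
  have h1P : ∀ b, |(shift (envM hε hε') 2⁻¹).onCircle b| ≤ 1 := fun b => by
    have := envP_onCircle_mem hε hε' b; rw [abs_of_nonneg this.1]; exact this.2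
  have h1M : ∀ b, |(envM hε hε').onCircle b| ≤ 1 := fun b => by
    have := envM_onCircle_mem hε hε' b; rw [abs_of_nonneg this.1]; exact this.2
  refine sq_sum_four_le ?_ ?_ ?_ ?_ ?_
  · have : (shift (envM hε hε') 2⁻¹).onCircle (y 0) * (envM hε hε').onCircle (y 1) *
          (wave hε hε' m a).D.onCircle (y 0 + y 1) *
        ((envM hε hε').onCircle (y 0) * (shift (envM hε hε') 2⁻¹).onCircle (y 1) *
          (wave hε hε' m a).D.onCircle (y 0 - y 1)) =
        ((shift (envM hε hε') 2⁻¹).onCircle (y 0) * (envM hε hε').onCircle (y 0)) *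
          ((envM hε hε').onCircle (y 1) * (shift (envM hε hε') 2⁻¹).onCircle (y 1) *
            (wave hε hε' m a).D.onCircle (y 0 + y 1) * (wave hε hε' m a).D.onCircle (y 0 - y 1)) := by ring
    rw [this, hAC, zero_mul]
  · simpa using abs_mul₃_le (h1P (y 0)) (h1M (y 1)) (abs_waveD_le hε hε' m a (y 0 + y 1))
  · simpa using abs_mul₃_le (h1M (y 0)) (h1P (y 1)) (abs_waveD_le hε hε' m a (y 0 - y 1))
  · simpa using abs_mul₃_le (abs_envPD_le hε hε' (y 0)) (h1M (y 1)) (abs_wave_onCircle_le hε hε' m a (y 0 + y 1))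
  · simpa using abs_mul₃_le (abs_envMD_le hε hε' (y 0)) (h1P (y 1)) (abs_wave_onCircle_le hε hε' m a (y 0 - y 1))

include hε hε' in
/-- **`T₁₁(u) ≤ 2a²ι² + 2K`.** [ours] -/
theorem vorticityMoment_one_one_le :
    vorticityMoment (u (base hε hε') (envM hε hε') (wave hε hε' m a)) 1 1 ≤
      2 * a ^ 2 * envMsq (envM hε hε') ^ 2 + 2 * Kc ε m a := by
  rw [vorticityMoment_one_one_u]
  have hmt := integral_mainTerm_le hε hε' m a
  have hc1 : Continuous fun y => Torus.partialDeriv 0 (w (envM hε hε') (wave hε hε' m a)) y ^ 2 :=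
    (continuous_partialDeriv_w _ _ 0).pow 2
  have hc2 : Continuous fun y => 2⁻¹ * mainTerm (envM hε hε') (wave hε hε' m a) y + 2 * Kc ε m a :=
    (continuous_const.mul (continuous_mainTerm _ _)).add continuous_const
  calc ∫ y, Torus.partialDeriv 0 (w (envM hε hε') (wave hε hε' m a)) y ^ 2
      ≤ ∫ y, (2⁻¹ * mainTerm (envM hε hε') (wave hε hε' m a) y + 2 * Kc ε m a) :=
        integral_mono hc1.integrable_unitAddTorus hc2.integrable_unitAddTorus
          fun y => sq_partialDeriv_zero_w_le hε hε' m a y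
    _ = 2⁻¹ * (∫ y, mainTerm (envM hε hε') (wave hε hε' m a) y) + 2 * Kc ε m a := by
        have i1 : Integrable (fun y => 2⁻¹ * mainTerm (envM hε hε') (wave hε hε' m a) y) volume :=
          (continuous_const.mul (continuous_mainTerm _ _)).integrable_unitAddTorus
        have i2 : Integrable (fun _ : UnitAddTorus (Fin 2) => 2 * Kc ε m a) volume := integrable_const _
        rw [integral_add i1 i2, integral_const_mul]
        simp
    _ ≤ 2 * a ^ 2 * envMsq (envM hε hε') ^ 2 + 2 * Kc ε m a := by nlinarith

end WaveMoment

/-! ## 3. The crude upper bound `ι ≤ ½ + 2ε` -/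

section EnvUpper

variable {ε : ℝ} (hε : 0 < ε) (hε' : ε ≤ 1 / 32)

include hε hε' in
/-- `η₋(t) = 0` on the `+1` plateau `[−¼ + 2ε, ¼]` of the slope wave. [ours; elementary] -/
theorem envM_eq_zero_of_mem {t : ℝ} (ht : t ∈ Icc (-4⁻¹ + 2 * ε) 4⁻¹) : envM hε hε' t = 0 := by
  have h1 : DEIJ.slopeWave ε t = 1 := slopeWave_eq_one hε (le_sixteenth hε') 0 (by simpa using ht)
  exact envM_eq_zero hε hε' (by rw [h1]; norm_num)

include hε hε' in
/-- **`ι = ∫₀¹η₋² ≤ ½ + 2ε`** (`η₋ ≤ 1` and `η₋ = 0` on the `+1` plateau of length `½ − 2ε`). [ours] -/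
theorem envMsq_le : envMsq (envM hε hε') ≤ 1 / 2 + 2 * ε := by
  set P := envM hε hε'
  have hcont : Continuous fun t => P t ^ 2 := P.continuous.pow 2
  have hi : ∀ a b : ℝ, IntervalIntegrable (fun t => P t ^ 2) volume a b := fun a b => hcont.intervalIntegrable a b
  have hper : Function.Periodic (fun t => P t ^ 2) 1 := fun t => by simp [P.periodic t]
  have hshift : envMsq P = ∫ t in (-4⁻¹ + 2 * ε)..(-4⁻¹ + 2 * ε + 1), P t ^ 2 := by
    rw [envMsq, hper.intervalIntegral_add_eq (-4⁻¹ + 2 * ε) 0, zero_add]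
  have hsplit : ∫ t in (-4⁻¹ + 2 * ε)..(-4⁻¹ + 2 * ε + 1), P t ^ 2 =
      (∫ t in (-4⁻¹ + 2 * ε)..4⁻¹, P t ^ 2) + ∫ t in (4⁻¹ : ℝ)..(-4⁻¹ + 2 * ε + 1), P t ^ 2 :=
    (intervalIntegral.integral_add_adjacent_intervals (hi _ _) (hi _ _)).symm
  have hz : ∫ t in (-4⁻¹ + 2 * ε)..4⁻¹, P t ^ 2 = 0 := by
    have : ∫ t in (-4⁻¹ + 2 * ε)..4⁻¹, P t ^ 2 = ∫ _t in (-4⁻¹ + 2 * ε)..4⁻¹, (0 : ℝ) := by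
      refine intervalIntegral.integral_congr fun t ht => ?_
      rw [uIcc_of_le (by linarith)] at ht
      simp [P, envM_eq_zero_of_mem hε hε' ht]
    rw [this, intervalIntegral.integral_const, smul_eq_mul, mul_zero]
  have hrest : ∫ t in (4⁻¹ : ℝ)..(-4⁻¹ + 2 * ε + 1), P t ^ 2 ≤ ∫ _t in (4⁻¹ : ℝ)..(-4⁻¹ + 2 * ε + 1), (1 : ℝ) :=
    intervalIntegral.integral_mono_on (by linarith) (hi _ _) intervalIntegrable_const fun t _ => by
      have h := envM_mem hε hε' t
      calc P t ^ 2 = P t * P t := sq _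
        _ ≤ 1 * 1 := mul_le_mul h.2 h.2 h.1 zero_le_one
        _ = 1 := one_mul _
  rw [intervalIntegral.integral_const, smul_eq_mul, mul_one] at hrest
  rw [hshift, hsplit, hz, zero_add]
  linarith

end EnvUpper

/-! ## 4. The filler family and `PlanarFillerFamilyPotMinus` -/

section Family

variable {ε : ℝ} (hε : 0 < ε) (hε' : ε ≤ 1 / 32)

include hε hε' in
/-- **Statistics of the cellular field at level `m ≥ 1`**: `|ω|² ≤ 4`, `σ ≥ 4a²((½−6ε)² − 4ε) − K`,
`2ℰ ≤ 2 + 4a²(½+2ε)² + K`, `T₂₂ ≥ 2 − 8ε`, `T₁₁ ≤ 2a²(½+2ε)² + 2K`. [ours] -/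
theorem cell_stats {m : ℕ} (hm : 0 < m) :
    (∀ x, torusVorticitySqAt ((u (base hε hε') (envM hε hε') (wave hε hε' m (amp (envLip ε) m)))) x ≤ 4) ∧
    4 * amp (envLip ε) m ^ 2 * ((1 / 2 - 6 * ε) ^ 2 - 4 * ε) - Kc ε m (amp (envLip ε) m) ≤
      enstrophyProduction ((u (base hε hε') (envM hε hε') (wave hε hε' m (amp (envLip ε) m)))) ∧
    2 * torusEnstrophy ((u (base hε hε') (envM hε hε') (wave hε hε' m (amp (envLip ε) m)))) ≤
      2 + 4 * amp (envLip ε) m ^ 2 * (1 / 2 + 2 * ε) ^ 2 + Kc ε m (amp (envLip ε) m) ∧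
    2 - 8 * ε ≤ vorticityMoment ((u (base hε hε') (envM hε hε') (wave hε hε' m (amp (envLip ε) m)))) 2 2 ∧
    vorticityMoment ((u (base hε hε') (envM hε hε') (wave hε hε' m (amp (envLip ε) m)))) 1 1 ≤
      2 * amp (envLip ε) m ^ 2 * (1 / 2 + 2 * ε) ^ 2 + 2 * Kc ε m (amp (envLip ε) m) := by
  set a := amp (envLip ε) m with ha
  have hL := envLip_nonneg hε hε'
  have hι0 : 0 ≤ 1 / 2 - 6 * ε := by linarith
  have hι1 := le_envMsq hε hε'
  have hι2 := envMsq_le hε hε'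
  have hιsq1 : (1 / 2 - 6 * ε) ^ 2 ≤ envMsq (envM hε hε') ^ 2 := pow_le_pow_left₀ hι0 hι1 2
  have hιsq2 : envMsq (envM hε hε') ^ 2 ≤ (1 / 2 + 2 * ε) ^ 2 := pow_le_pow_left₀ (hι0.trans hι1) hι2 2
  have hs := slack_mem hε hε'
  have hμ := msqD_base_eq hε hε'
  have ha2 : 0 ≤ a ^ 2 := sq_nonneg a
  refine ⟨fun x => ?_, ?_, ?_, ?_, ?_⟩
  · have h := torusVorticitySqAt_cell_le hε hε' m a x
    rwa [vortBound_amp hL hm] at h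
  · have hσ := integral_mainTerm_sub_le_production hε hε' m a
    have hlow := le_integral_mainTerm hε hε' a hm
    have h1 : 4 * a ^ 2 * ((1 / 2 - 6 * ε) ^ 2 - 4 * ε) ≤ 4 * a ^ 2 * (envMsq (envM hε hε') ^ 2 - slack ε) :=
      mul_le_mul_of_nonneg_left (by linarith [hs.2]) (by positivity)
    show 4 * a ^ 2 * ((1 / 2 - 6 * ε) ^ 2 - 4 * ε) - Kc ε m a ≤ enstrophyProduction ((u (base hε hε') (envM hε hε') (wave hε hε' m (amp (envLip ε) m))))
    linarith
  · have hE := two_mul_torusEnstrophy_le hε hε' m a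
    have hup := integral_mainTerm_le hε hε' m a
    have h1 : 4 * a ^ 2 * envMsq (envM hε hε') ^ 2 ≤ 4 * a ^ 2 * (1 / 2 + 2 * ε) ^ 2 :=
      mul_le_mul_of_nonneg_left hιsq2 (by positivity)
    show 2 * torusEnstrophy ((u (base hε hε') (envM hε hε') (wave hε hε' m (amp (envLip ε) m)))) ≤ 2 + 4 * a ^ 2 * (1 / 2 + 2 * ε) ^ 2 + Kc ε m a
    linarith [hs.1]
  · rw [vorticityMoment_two_two_u, hμ]; linarith [hs.2]
  · have h := vorticityMoment_one_one_le hε hε' m a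
    have h1 : 2 * a ^ 2 * envMsq (envM hε hε') ^ 2 ≤ 2 * a ^ 2 * (1 / 2 + 2 * ε) ^ 2 :=
      mul_le_mul_of_nonneg_left hιsq2 (by positivity)
    show vorticityMoment ((u (base hε hε') (envM hε hε') (wave hε hε' m (amp (envLip ε) m)))) 1 1 ≤ 2 * a ^ 2 * (1 / 2 + 2 * ε) ^ 2 + 2 * Kc ε m a
    linarith

include hε hε' in
/-- **Limits of the three bound expressions** as `m → ∞` (`a_m² → 2`, `K_m → 0`). [ours] -/
theorem tendsto_bounds :
    Tendsto (fun m : ℕ => (4 * amp (envLip ε) m ^ 2 * ((1 / 2 - 6 * ε) ^ 2 - 4 * ε) - Kc ε m (amp (envLip ε) m)) / 8)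
      atTop (𝓝 ((4 * 2 * ((1 / 2 - 6 * ε) ^ 2 - 4 * ε) - 0) / 8)) ∧
    Tendsto (fun m : ℕ => (2 + 4 * amp (envLip ε) m ^ 2 * (1 / 2 + 2 * ε) ^ 2 + Kc ε m (amp (envLip ε) m)) / 8)
      atTop (𝓝 ((2 + 4 * 2 * (1 / 2 + 2 * ε) ^ 2 + 0) / 8)) ∧
    Tendsto (fun m : ℕ => (2 - 8 * ε - (2 * amp (envLip ε) m ^ 2 * (1 / 2 + 2 * ε) ^ 2 +
        2 * Kc ε m (amp (envLip ε) m))) / 4) atTop (𝓝 ((2 - 8 * ε - (2 * 2 * (1 / 2 + 2 * ε) ^ 2 + 2 * 0)) / 4)) := by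
  have ha := tendsto_amp_sq (L := envLip ε)
  have hK := tendsto_Kc (ε := ε) (envLip_nonneg hε hε') rfl
  refine ⟨?_, ?_, ?_⟩
  · exact (((ha.const_mul 4).mul_const _).sub hK).div_const 8
  · exact ((tendsto_const_nhds.add ((ha.const_mul 4).mul_const _)).add hK).div_const 8
  · exact (tendsto_const_nhds.sub (((ha.const_mul 2).mul_const _).add (hK.const_mul 2))).div_const 4

end Family

/-- **N3− of the bank's wrap blueprint holds: `PlanarFillerFamilyPotMinus`.** For every `ε > 0` there is a
smooth potential `A` on `T³` whose curl `F` has `|ω_F|² ≤ 1`, `σ(F) ≥ ¼ − ε`, `ℰ(F) ≤ ½ + ε` and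
`T₂₂(F) − T₁₁(F) ≥ ¼ − ε`: `F` is (up to its mean) one half of the exact-plateau cellular field with small
plateau parameter and large internal frequency. Search for candidate a priori estimates; no regularity claim.
[ours] -/
theorem planarFillerFamilyPotMinus_holds : PlanarFillerFamilyPotMinus := by
  intro ε₀ hε₀
  -- the plateau parameter
  set ε : ℝ := min (1 / 32) (ε₀ / 64) with hεdef
  have hε : 0 < ε := lt_min (by norm_num) (by linarith)
  have hε' : ε ≤ 1 / 32 := min_le_left _ _
  have hεε : ε ≤ ε₀ / 64 := min_le_right _ _
  obtain ⟨tσ, tE, tT⟩ := tendsto_bounds hε hε'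
  -- the limits beat the targets strictly
  have lσ : 1 / 4 - ε₀ < (4 * 2 * ((1 / 2 - 6 * ε) ^ 2 - 4 * ε) - 0) / 8 := by nlinarith
  have lE : (2 + 4 * 2 * (1 / 2 + 2 * ε) ^ 2 + 0) / 8 < 1 / 2 + ε₀ := by nlinarith
  have lT : 1 / 4 - ε₀ < (2 - 8 * ε - (2 * 2 * (1 / 2 + 2 * ε) ^ 2 + 2 * 0)) / 4 := by nlinarith
  have eσ := tσ.eventually (eventually_gt_nhds lσ)
  have eE := tE.eventually (eventually_lt_nhds lE)
  have eT := tT.eventually (eventually_gt_nhds lT)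
  obtain ⟨m, hm⟩ := ((eσ.and eE).and (eT.and (eventually_gt_atTop 0))).exists
  obtain ⟨⟨hmσ, hmE⟩, hmT, hm0⟩ := hm
  obtain ⟨hsup, hσ, hE, hT2, hT1⟩ := cell_stats hε hε' hm0
  -- the halved field and its potential
  have hus : IsSmooth ((u (base hε hε') (envM hε hε') (wave hε hε' m (amp (envLip ε) m)))) := isSmooth_u _ _ _
  have hud : IsDivFree ((u (base hε hε') (envM hε hε') (wave hε hε' m (amp (envLip ε) m)))) := isDivFree_u _ _ _
  set v := (2⁻¹ : ℝ) • (u (base hε hε') (envM hε hε') (wave hε hε' m (amp (envLip ε) m))) with hv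
  have hvs : IsSmooth v := hus.smul _
  have hvd : IsDivFree v := isDivFree_const_smul (hus.isContDiff (by simp)) hud _
  obtain ⟨A, hA, hAω, hAE, hAσ, hAT⟩ := exists_potential hvs hvd
  refine ⟨A, hA, fun x => ?_, ?_, ?_, ?_⟩
  · rw [hAω x, hv, torusVorticitySqAt_const_smul hus]
    have := hsup x
    nlinarith
  · rw [hAσ, hv, enstrophyProduction_const_smul hus]
    have e : (2⁻¹ : ℝ) ^ 3 * enstrophyProduction ((u (base hε hε') (envM hε hε') (wave hε hε' m (amp (envLip ε) m)))) = enstrophyProduction ((u (base hε hε') (envM hε hε') (wave hε hε' m (amp (envLip ε) m)))) / 8 := by ring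
    rw [e]
    have := div_le_div_of_nonneg_right hσ (by norm_num : (0 : ℝ) ≤ 8)
    linarith
  · rw [hAE, hv, torusEnstrophy_const_smul (hus.isContDiff (by simp))]
    have e : (2⁻¹ : ℝ) ^ 2 * torusEnstrophy ((u (base hε hε') (envM hε hε') (wave hε hε' m (amp (envLip ε) m)))) = 2 * torusEnstrophy ((u (base hε hε') (envM hε hε') (wave hε hε' m (amp (envLip ε) m)))) / 8 := by ring
    rw [e]
    have := div_le_div_of_nonneg_right hE (by norm_num : (0 : ℝ) ≤ 8)
    linarith
  · rw [hAT, hAT, hv, vorticityMoment_const_smul hus, vorticityMoment_const_smul hus]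
    have e : (2⁻¹ : ℝ) ^ 2 * vorticityMoment ((u (base hε hε') (envM hε hε') (wave hε hε' m (amp (envLip ε) m)))) 2 2 - (2⁻¹ : ℝ) ^ 2 * vorticityMoment ((u (base hε hε') (envM hε hε') (wave hε hε' m (amp (envLip ε) m)))) 1 1 =
        (vorticityMoment ((u (base hε hε') (envM hε hε') (wave hε hε' m (amp (envLip ε) m)))) 2 2 - vorticityMoment ((u (base hε hε') (envM hε hε') (wave hε hε' m (amp (envLip ε) m)))) 1 1) / 4 := by ring
    rw [e]
    have h4 : (2 - 8 * ε - (2 * amp (envLip ε) m ^ 2 * (1 / 2 + 2 * ε) ^ 2 + 2 * Kc ε m (amp (envLip ε) m))) / 4 ≤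
        (vorticityMoment ((u (base hε hε') (envM hε hε') (wave hε hε' m (amp (envLip ε) m)))) 2 2 - vorticityMoment ((u (base hε hε') (envM hε hε') (wave hε hε' m (amp (envLip ε) m)))) 1 1) / 4 :=
      div_le_div_of_nonneg_right (by linarith) (by norm_num)
    linarith

end FillerMinus

end Summit.NavierStokesRegularity.FunctionalMining

end
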